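import Mathlib
import HarnessLib
import Summits.NavierStokesRegularity.NavierStokesRegularity.Theorems.UnthreadedRigidityDoorUnthreadedRigidityVirialHornCoherentFrame

/-!
# VIRIAL HORN, W-ii (3/6): THE CERTIFICATE TABLE — generating function of the brackets of the frame and the Laplacian ladder

Route `UnthreadedRigidityDoor`, item `UnthreadedRigidity` (W2, stmt-NavierStokesRegularity-27585) — LINE g11-1 «VIRIAL HORN»,
DIRECTOR-NS KEY-NS #210 (W-ii): the ALL-DEGREE BRACKET INJECTIVITY `bracketInjective_all` (= the hypothesis `hinj` of p712484
`windowWedgeAnalyticL_of_bracketInjective`, every `l ≥ 1`), by a kernel road that needs neither the `SO(3)`-isotypic decomposition of `Λ²𝓗_l`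
nor a closed form of Legendre coefficients (ns-crc-p2 g10; `--supports stmt-NavierStokesRegularity-27585`, helper; 0 kit).

CONTENT.  With the polar form `ell = W + (s+t)Z − stV`, the Casimir `r2 = WV + Z²`, `dST = t − s` and `Psi = ell² − dST²·r2 = q(s)q(t)`:
★ `tripleG_qs_qt : {q(s), q(t)} = 2(t−s)ℓ` and `tripleG_qs_pow_qt_pow : {q(s)^l, q(t)^l} = 2l²(t−s)·ℓ·Ψ^{l−1}` (the bracket of two coherent
states is the zonal cubic-type polynomial with axis the polar vector); the metric data `|∇ℓ|² = (t−s)²`, `∇ℓ·∇r² = 2ℓ`, `|∇r²|² = 4r²`, `Δℓ = 0`,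
`Δr² = 6`, hence `∇ℓ·∇Ψ = 0`, `ΔΨ = −4(t−s)²`, `|∇Ψ|² = −4(t−s)²Ψ`; ★ THE LAPLACIAN LADDER `Δ(ℓΨ^{m+1}) = −4(m+1)²(t−s)²·ℓΨ^m` and its iterate
`Δ^i(ℓΨ^n) = κ(n,i)(t−s)^{2i} ℓΨ^{n−i}`, `κ(n,i) = (−4)^i (n!/(n−i)!)² ≠ 0` (`ladder`); evaluation `evG` at the NULL POINT `(W,V,Z) = (1,0,0)`
(parameters kept; `evG (incl P) = C (P(1,0,0))`), where `ℓ ↦ 1`, `Ψ ↦ 1`; ★★ THE CERTIFICATE TABLE `eval_iterate_lapC_tripleC_Phi`: for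
`i + 1 ≤ l`, `(Δ̃^i {Φ_{l,j}, Φ_{l,k}})(1,0,0) = 2l² κ(l−1,i) (−1)^j C(2i+1,j)` if `j + k = 2i+1` and `0` otherwise (coefficient extraction
from `evG(Δ^i{q(s)^l,q(t)^l}) = 2l²κ(l−1,i)(t−s)^{2i+1}`).  These `l` linear functionals `P ↦ (Δ̃^i P)(1,0,0)` replace both the Schur step and
the Legendre/Gradshteyn–Ryzhik coefficient of the paper proof of record (tribunal T2 GEN47).

HONEST LABEL: finite-dimensional polynomial algebra about solid harmonics (W1's complex-coordinate currency `Zonal.CPoly = ℂ[W,V,Z]`,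
`tripleC = −i·det(∇·,∇·,x)`, `lapC`, imported by name — nothing is re-declared); no statement about Navier–Stokes solutions is made or
proved in this file; `UnthreadedRigidity` ⟨27585⟩, W2 and NS regularity remain OPEN.  [folklore]
-/

-- the summit and its single sub-problem share the name (CONVENTIONS §1)
set_option linter.dupNamespace false

noncomputable section

open MvPolynomial Finsupp

namespace Summit.NavierStokesRegularity.NavierStokesRegularity.Theorems.UnthreadedRigidity.VirialHorn.Coherent

open Summit.NavierStokesRegularity.NavierStokesRegularity.Theorems.PoloidalLiouville.HorizonTower.Zonal
  (CPoly wt lapC lam tripleC dotC tri)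

/-! ## C. The certificate functionals: generating function of the bracket table and the Laplacian ladder -/

section Certificate

/-- the POLAR FORM `ℓ(s,t) = W + (s+t)Z − st V` of the generating element (`ℓ(s,s) = q(s)`). -/
def ell : GPoly := X 0 + (X 3 + X 4) * X 2 - X 3 * X 4 * X 1

/-- the Casimir `r² = WV + Z²`. -/
def r2 : GPoly := X 0 * X 1 + X 2 ^ 2

/-- the parameter difference `dST = t − s`. -/
def dST : GPoly := X 4 - X 3

/-- `Psi = ℓ² − dST² r²` (`= q(s) q(t)`). -/
def Psi : GPoly := ell ^ 2 - dST ^ 2 * r2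

/-- `t − s` is a parameter. -/
theorem isParam_dST : IsParam dST := isParam_X_four.sub isParam_X_three

/-- DISCRIMINANT IDENTITY: `q(s) q(t) = ℓ² − (t−s)² r²`. -/
theorem qs_mul_qt : qs * qt = Psi := by
  unfold qs qt Psi ell dST r2; rw [C_two]; ring

/-- `∂_W q(t) = 1`. -/
theorem pderiv_zero_qt : pderiv 0 qt = 1 := by
  simp only [qt, map_add, map_sub, pderiv_mul, pderiv_pow, pderiv_C, pderiv_X_self,
    pderiv_X_of_ne (show (1 : Fin 5) ≠ 0 by decide), pderiv_X_of_ne (show (2 : Fin 5) ≠ 0 by decide),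
    pderiv_X_of_ne (show (4 : Fin 5) ≠ 0 by decide)]
  ring

/-- `∂_V q(t) = −t²`. -/
theorem pderiv_one_qt : pderiv 1 qt = -X 4 ^ 2 := by
  simp only [qt, map_add, map_sub, pderiv_mul, pderiv_pow, pderiv_C, pderiv_X_self,
    pderiv_X_of_ne (show (0 : Fin 5) ≠ 1 by decide), pderiv_X_of_ne (show (2 : Fin 5) ≠ 1 by decide),
    pderiv_X_of_ne (show (4 : Fin 5) ≠ 1 by decide)]
  ring

/-- `∂_Z q(t) = 2t`. -/
theorem pderiv_two_qt : pderiv 2 qt = C (2 : ℂ) * X 4 := by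
  simp only [qt, map_add, map_sub, pderiv_mul, pderiv_pow, pderiv_C, pderiv_X_self,
    pderiv_X_of_ne (show (0 : Fin 5) ≠ 2 by decide), pderiv_X_of_ne (show (1 : Fin 5) ≠ 2 by decide),
    pderiv_X_of_ne (show (4 : Fin 5) ≠ 2 by decide)]
  ring

/-- ★ THE BRACKET OF TWO COHERENT STATES: `{q(s), q(t)} = 2 (t−s) ℓ(s,t)`. -/
theorem tripleG_qs_qt : tripleG qs qt = 2 * dST * ell := by
  rw [tripleG, lamG, lamG, pderiv_zero_qs, pderiv_one_qs, pderiv_two_qs, pderiv_zero_qt, pderiv_one_qt, pderiv_two_qt, C_two]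
  unfold dST ell
  ring

/-- ★ GENERATING FUNCTION OF THE BRACKET TABLE: `{q(s)^l, q(t)^l} = 2l² (t−s) ℓ Psi^{l−1}`. -/
theorem tripleG_qs_pow_qt_pow (l : ℕ) :
    tripleG (qs ^ l) (qt ^ l) = C (2 * (l : ℂ) ^ 2) * dST * (ell * Psi ^ (l - 1)) := by
  rw [tripleG_pow_pow, tripleG_qs_qt, ← qs_mul_qt, mul_pow, map_mul, map_pow, map_natCast, C_two]
  ring

/-- `∂_W ℓ = 1`. -/
theorem pderiv_zero_ell : pderiv 0 ell = 1 := by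
  simp only [ell, map_add, map_sub, pderiv_mul, pderiv_X_self,
    pderiv_X_of_ne (show (1 : Fin 5) ≠ 0 by decide), pderiv_X_of_ne (show (2 : Fin 5) ≠ 0 by decide),
    pderiv_X_of_ne (show (3 : Fin 5) ≠ 0 by decide), pderiv_X_of_ne (show (4 : Fin 5) ≠ 0 by decide)]
  ring

/-- `∂_V ℓ = −st`. -/
theorem pderiv_one_ell : pderiv 1 ell = -(X 3 * X 4) := by
  simp only [ell, map_add, map_sub, pderiv_mul, pderiv_X_self,
    pderiv_X_of_ne (show (0 : Fin 5) ≠ 1 by decide), pderiv_X_of_ne (show (2 : Fin 5) ≠ 1 by decide),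
    pderiv_X_of_ne (show (3 : Fin 5) ≠ 1 by decide), pderiv_X_of_ne (show (4 : Fin 5) ≠ 1 by decide)]
  ring

/-- `∂_Z ℓ = s + t`. -/
theorem pderiv_two_ell : pderiv 2 ell = X 3 + X 4 := by
  simp only [ell, map_add, map_sub, pderiv_mul, pderiv_X_self,
    pderiv_X_of_ne (show (0 : Fin 5) ≠ 2 by decide), pderiv_X_of_ne (show (1 : Fin 5) ≠ 2 by decide),
    pderiv_X_of_ne (show (3 : Fin 5) ≠ 2 by decide), pderiv_X_of_ne (show (4 : Fin 5) ≠ 2 by decide)]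
  ring

/-- `∂_W r² = V`. -/
theorem pderiv_zero_r2 : pderiv 0 r2 = X 1 := by
  simp only [r2, map_add, pderiv_mul, pderiv_pow, pderiv_X_self, pderiv_X_of_ne (show (1 : Fin 5) ≠ 0 by decide),
    pderiv_X_of_ne (show (2 : Fin 5) ≠ 0 by decide)]
  ring

/-- `∂_V r² = W`. -/
theorem pderiv_one_r2 : pderiv 1 r2 = X 0 := by
  simp only [r2, map_add, pderiv_mul, pderiv_pow, pderiv_X_self, pderiv_X_of_ne (show (0 : Fin 5) ≠ 1 by decide),
    pderiv_X_of_ne (show (2 : Fin 5) ≠ 1 by decide)]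
  ring

/-- `∂_Z r² = 2Z`. -/
theorem pderiv_two_r2 : pderiv 2 r2 = 2 * X 2 := by
  simp only [r2, map_add, pderiv_mul, pderiv_pow, pderiv_X_self, pderiv_X_of_ne (show (0 : Fin 5) ≠ 2 by decide),
    pderiv_X_of_ne (show (1 : Fin 5) ≠ 2 by decide)]
  ring

/-- `ℓ` is harmonic (it is linear in `W, V, Z`). -/
theorem lapG_ell : lapG ell = 0 := by
  rw [lapG, pderiv_one_ell, pderiv_two_ell, map_neg, (isParam_X_three.mul isParam_X_four).d0,
    (isParam_X_three.add isParam_X_four).d2]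
  ring

/-- `|∇ℓ|² = (t − s)²`. -/
theorem dotG_ell_ell : dotG ell ell = dST ^ 2 := by
  rw [dotG, pderiv_zero_ell, pderiv_one_ell, pderiv_two_ell, C_two]; unfold dST; ring

/-- `∇ℓ·∇r² = 2ℓ` (Euler). -/
theorem dotG_ell_r2 : dotG ell r2 = 2 * ell := by
  rw [dotG, pderiv_zero_ell, pderiv_one_ell, pderiv_two_ell, pderiv_zero_r2, pderiv_one_r2, pderiv_two_r2, C_two]
  unfold ell; ring

/-- `|∇r²|² = 4r²`. -/
theorem dotG_r2_r2 : dotG r2 r2 = 4 * r2 := by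
  rw [dotG, pderiv_zero_r2, pderiv_one_r2, pderiv_two_r2, C_two]; unfold r2; ring

/-- `2 = C 2` is a parameter (constant). -/
theorem isParam_two : IsParam (2 : GPoly) := by rw [← C_two]; exact isParam_C 2

/-- `Δ r² = 6`. -/
theorem lapG_r2 : lapG r2 = 6 := by
  rw [lapG, pderiv_one_r2, pderiv_two_r2, pderiv_X_self, isParam_two.pderiv_mul_two, pderiv_X_self, C_four]
  ring

/-- `Δ̃` of a difference. -/
theorem lapG_sub (F G : GPoly) : lapG (F - G) = lapG F - lapG G := by
  simp only [lapG, map_sub]; ring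

/-- Leibniz rule for the gradient pairing in the second slot. -/
theorem dotG_mul_right (F G H : GPoly) : dotG F (G * H) = G * dotG F H + H * dotG F G := by
  rw [dotG_comm, dotG_mul_left, dotG_comm H, dotG_comm G]

/-- the gradient pairing respects subtraction (right). -/
theorem dotG_sub_right (F G H : GPoly) : dotG F (G - H) = dotG F G - dotG F H := by
  rw [dotG_comm, dotG_sub_left, dotG_comm G, dotG_comm H]

/-- `∇ℓ·∇Psi = 0`. -/
theorem dotG_ell_Psi : dotG ell Psi = 0 := by
  rw [Psi, dotG_sub_right, pow_two, dotG_mul_right, (isParam_dST.pow 2).dotG_mul_right, dotG_ell_ell, dotG_ell_r2]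
  ring

/-- `Δ Psi = −4 (t−s)²`. -/
theorem lapG_Psi : lapG Psi = -(4 * dST ^ 2) := by
  rw [Psi, lapG_sub, pow_two, lapG_mul, (isParam_dST.pow 2).lapG_mul, lapG_ell, dotG_ell_ell, lapG_r2]
  ring

/-- `|∇Psi|² = −4 (t−s)² Psi` — the gradient of `Psi` is null ON `Psi = 0`, the key to the ladder. -/
theorem dotG_Psi_Psi : dotG Psi Psi = -(4 * dST ^ 2) * Psi := by
  have hPsi : Psi = ell * ell - dST ^ 2 * r2 := by rw [Psi, pow_two]
  have h1 : dotG Psi ell = 0 := by rw [dotG_comm, dotG_ell_Psi]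
  have h2 : dotG Psi r2 = 4 * Psi := by
    rw [dotG_comm, hPsi, dotG_sub_right, dotG_mul_right, (isParam_dST.pow 2).dotG_mul_right, dotG_comm r2 ell,
      dotG_ell_r2, dotG_r2_r2]
    ring
  rw [show dotG Psi Psi = dotG Psi (ell * ell - dST ^ 2 * r2) by rw [← hPsi], dotG_sub_right, dotG_mul_right,
    (isParam_dST.pow 2).dotG_mul_right, h1, h2, hPsi]
  ring

/-- ★ THE LAPLACIAN LADDER: `Δ(ℓ Psi^{m+1}) = −4 (m+1)² (t−s)² · ℓ Psi^m`. -/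
theorem lapG_ell_mul_Psi_pow_succ (m : ℕ) :
    lapG (ell * Psi ^ (m + 1)) = -(4 * ((m : GPoly) + 1) ^ 2 * dST ^ 2) * (ell * Psi ^ m) := by
  induction m with
  | zero =>
    rw [zero_add, pow_one, pow_zero, mul_one, lapG_mul, lapG_ell, dotG_ell_Psi, lapG_Psi]
    push_cast
    ring
  | succ m ih =>
    rw [pow_succ, ← mul_assoc, lapG_mul, ih, dotG_mul_left, dotG_pow_succ_left, dotG_ell_Psi, dotG_Psi_Psi, lapG_Psi]
    push_cast
    ring

/-- the ladder constant `κ(n,i) = (−4)^i (n!/(n−i)!)²`. -/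
def ladder (n i : ℕ) : ℂ := (-4 : ℂ) ^ i * ((Nat.descFactorial n i : ℕ) : ℂ) ^ 2

/-- `κ(n,0) = 1`. -/
theorem ladder_zero (n : ℕ) : ladder n 0 = 1 := by simp [ladder]

/-- `κ(n,i+1) = −4 (n−i)² κ(n,i)`. -/
theorem ladder_succ (n i : ℕ) : ladder n (i + 1) = ladder n i * (-4) * ((n - i : ℕ) : ℂ) ^ 2 := by
  simp only [ladder, Nat.descFactorial_succ, pow_succ, Nat.cast_mul]
  ring

/-- `κ(n,i) ≠ 0` for `i ≤ n`. -/
theorem ladder_ne_zero {n i : ℕ} (hi : i ≤ n) : ladder n i ≠ 0 := by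
  have h : Nat.descFactorial n i ≠ 0 := by
    rw [← Nat.pos_iff_ne_zero, Nat.descFactorial_pos]; exact hi
  simp [ladder, h]

/-- iterated Laplacian commutes with parameter multiples. -/
theorem IsParam.iterate_lapG_mul {p : GPoly} (hp : IsParam p) (F : GPoly) (i : ℕ) : lapG^[i] (p * F) = p * lapG^[i] F := by
  induction i with
  | zero => rfl
  | succ i ih => rw [Function.iterate_succ_apply', Function.iterate_succ_apply', ih, hp.lapG_mul]

/-- ★ ITERATED LADDER: `Δ^i (ℓ Psi^n) = κ(n,i) (t−s)^{2i} ℓ Psi^{n−i}` for `i ≤ n`. -/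
theorem iterate_lapG_ell_mul_Psi_pow (n : ℕ) : ∀ i, i ≤ n →
    lapG^[i] (ell * Psi ^ n) = C (ladder n i) * dST ^ (2 * i) * (ell * Psi ^ (n - i)) := by
  intro i
  induction i with
  | zero => intro _; simp [ladder_zero]
  | succ i ih =>
    intro hi
    obtain ⟨m, hm⟩ : ∃ m, n - i = m + 1 := ⟨n - i - 1, by omega⟩
    have hm' : n - (i + 1) = m := by omega
    rw [Function.iterate_succ_apply', ih (by omega), ((isParam_C _).mul (isParam_dST.pow _)).lapG_mul, hm,
      lapG_ell_mul_Psi_pow_succ, hm', ladder_succ, show n - i = m + 1 from hm]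
    simp only [map_mul, map_pow, map_neg, Nat.cast_succ, map_add, map_natCast, map_one, map_ofNat]
    ring

/-! ### evaluation at the null point `(W,V,Z) = (1,0,0)`, parameters kept -/

/-- evaluation `W ↦ 1, V ↦ 0, Z ↦ 0`, `s, t` kept. -/
def evG : GPoly →ₐ[ℂ] GPoly := aeval ![1, 0, 0, X 3, X 4]

/-- `W ↦ 1`. -/
@[simp] theorem evG_X_zero : evG (X 0) = 1 := by simp [evG]
/-- `V ↦ 0`. -/
@[simp] theorem evG_X_one : evG (X 1) = 0 := by simp [evG]
/-- `Z ↦ 0`. -/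
@[simp] theorem evG_X_two : evG (X 2) = 0 := by simp [evG]
/-- `s ↦ s`. -/
@[simp] theorem evG_X_three : evG (X 3) = X 3 := by simp [evG]
/-- `t ↦ t`. -/
@[simp] theorem evG_X_four : evG (X 4) = X 4 := by simp [evG]
/-- constants are kept. -/
@[simp] theorem evG_C (c : ℂ) : evG (C c) = C c := by simp [evG]

/-- `ℓ ↦ 1` at the null point. -/
theorem evG_ell : evG ell = 1 := by simp [ell]
/-- `r² ↦ 0` at the null point. -/
theorem evG_r2 : evG r2 = 0 := by simp [r2]
/-- `t − s` is kept. -/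
theorem evG_dST : evG dST = dST := by simp [dST]
/-- `Ψ ↦ 1` at the null point. -/
theorem evG_Psi : evG Psi = 1 := by simp [Psi, map_sub, map_mul, map_pow, evG_ell, evG_r2]

/-- the null point `(1, 0, 0)` of `ℂ[W,V,Z]` (`r² = WV + Z² = 0` there). -/
def e0 : Fin 3 → ℂ := ![1, 0, 0]

/-- scalar extension of evaluation: `aeval (C ∘ x) P = C (eval x P)`. -/
theorem aeval_C_comp (x : Fin 3 → ℂ) (P : CPoly) : aeval (fun i => (C (x i) : GPoly)) P = C (eval x P) := by
  induction P using MvPolynomial.induction_on with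
  | C a => rw [aeval_C, eval_C, algebraMap_eq]
  | add p q hp hq => rw [map_add, map_add, hp, hq, map_add]
  | mul_X p i hp => rw [map_mul, map_mul, aeval_X, hp, eval_X, map_mul]

/-- evaluation of the embedded polynomials gives constants: `evG (incl P) = C (P(1,0,0))`. -/
theorem evG_incl (P : CPoly) : evG (incl P) = C (eval e0 P) := by
  have hg : ((![1, 0, 0, X 3, X 4] : Fin 5 → GPoly) ∘ emb) = fun i => C (e0 i) := by
    funext i; fin_cases i <;> simp [emb, e0, Fin.castLE]
  rw [evG, incl, aeval_rename, hg, aeval_C_comp]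

/-- ★ CLOSED FORM OF THE CERTIFICATE: `evG (Δ^i {q(s)^l, q(t)^l}) = 2l² κ(l−1,i) (t−s)^{2i+1}` for `i ≤ l−1`. -/
theorem evG_iterate_lapG_tripleG {l i : ℕ} (hi : i + 1 ≤ l) :
    evG (lapG^[i] (tripleG (qs ^ l) (qt ^ l))) = C (2 * (l : ℂ) ^ 2 * ladder (l - 1) i) * dST ^ (2 * i + 1) := by
  rw [tripleG_qs_pow_qt_pow, ((isParam_C _).mul isParam_dST).iterate_lapG_mul, iterate_lapG_ell_mul_Psi_pow (l - 1) i (by omega)]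
  simp only [map_mul, map_pow, evG_dST, evG_ell, evG_Psi, evG_C]
  ring

/-! ### the expansion side -/

/-- termwise bracket under the double expansion. -/
theorem tripleG_term (P Q : CPoly) (j k : ℕ) :
    tripleG (incl P * X 3 ^ j) (incl Q * X 4 ^ k) = incl (tripleC P Q) * X 3 ^ j * X 4 ^ k := by
  rw [mul_comm (incl P), mul_comm (incl Q), (isParam_X_three.pow j).tripleG_mul_left, (isParam_X_four.pow k).tripleG_mul_right,
    tripleG_incl]
  ring

/-- termwise iterated Laplacian under the double expansion. -/
theorem iterate_lapG_term (P : CPoly) (j k i : ℕ) :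
    lapG^[i] (incl P * X 3 ^ j * X 4 ^ k) = incl (lapC^[i] P) * X 3 ^ j * X 4 ^ k := by
  induction i generalizing P with
  | zero => rfl
  | succ i ih =>
    rw [Function.iterate_succ_apply, Function.iterate_succ_apply, ← ih (lapC P), ← lapG_incl]
    congr 1
    rw [mul_assoc, mul_comm (incl P), ((isParam_X_three.pow j).mul (isParam_X_four.pow k)).lapG_mul, mul_comm, mul_assoc]

/-- iterated `Δ̃` over finite sums. -/
theorem iterate_lapG_sum {α : Type*} (s : Finset α) (F : α → GPoly) (i : ℕ) :
    lapG^[i] (∑ a ∈ s, F a) = ∑ a ∈ s, lapG^[i] (F a) := by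
  induction i generalizing F with
  | zero => rfl
  | succ i ih => rw [Function.iterate_succ_apply, lapG_sum, ih]; rfl

/-- ★ EXPANSION OF THE CERTIFICATE: `evG (Δ^i {q(s)^l, q(t)^l}) = Σ_{j,k ≤ 2l} (Δ^i{Φ_j,Φ_k})(1,0,0) s^j t^k`. -/
theorem evG_iterate_lapG_tripleG_eq_sum (l i : ℕ) :
    evG (lapG^[i] (tripleG (qs ^ l) (qt ^ l)))
      = ∑ j ∈ Finset.range (2 * l + 1), ∑ k ∈ Finset.range (2 * l + 1),
          incl (C (eval e0 (lapC^[i] (tripleC (Phi l j) (Phi l k))))) * X 3 ^ j * X 4 ^ k := by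
  rw [qs_pow_eq_sum, qt_pow_eq_sum, tripleG_sum_left]
  simp only [tripleG_sum_right, tripleG_term, iterate_lapG_sum, iterate_lapG_term, map_sum, map_mul, map_pow, evG_incl, incl_C,
    evG_X_three, evG_X_four]

/-- the coefficient of `s^j t^k` in `c · (t − s)^n`. -/
theorem coeff_ext_C_mul_dST_pow (c : ℂ) (n j k : ℕ) :
    coeff (ext 0 j k) (C c * dST ^ n) = if j + k = n then c * (-1) ^ j * (n.choose j : ℂ) else 0 := by
  classical
  rw [dST, sub_pow, Finset.mul_sum]
  have h : ∀ m ∈ Finset.range (n + 1), C c * ((-1) ^ (m + n) * X 4 ^ m * X 3 ^ (n - m) * (n.choose m : GPoly))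
      = incl (C (c * (-1) ^ (m + n) * (n.choose m : ℂ))) * X 3 ^ (n - m) * X 4 ^ m := by
    intro m _
    rw [incl_C, map_mul, map_mul, map_pow, map_neg, map_one, map_natCast]
    ring
  rw [Finset.sum_congr rfl h]
  simp only [coeff_sum, coeff_ext_incl_mul, coeff_C, if_true]
  by_cases hjk : j + k = n
  · rw [if_pos hjk, Finset.sum_eq_single k]
    · rw [if_pos ⟨by omega, rfl⟩]
      subst hjk
      rw [Nat.choose_symm_add, show (-1 : ℂ) ^ (k + (j + k)) = (-1) ^ j by
        rw [show k + (j + k) = j + 2 * k by ring, pow_add, pow_mul]; norm_num]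
    · intro m _ hm; rw [if_neg]; rintro ⟨_, h2⟩; exact hm h2
    · intro hk; rw [if_neg]; rintro ⟨-, -⟩; exact hk (Finset.mem_range.mpr (by omega))
  · rw [if_neg hjk]
    refine Finset.sum_eq_zero fun m hm => ?_
    rw [if_neg]
    rintro ⟨h1, rfl⟩
    exact hjk (by have := Finset.mem_range.mp hm; omega)

/-- iterates of the Laplacian kill `0`. -/
theorem iterate_lapC_zero (i : ℕ) : lapC^[i] (0 : CPoly) = 0 := by
  induction i with
  | zero => rfl
  | succ i ih => rw [Function.iterate_succ_apply', ih]; simp [lapC]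

/-- ★★ THE CERTIFICATE TABLE: for `i + 1 ≤ l` and all `j, k`,
`(Δ̃^i {Φ_{l,j}, Φ_{l,k}})(1,0,0) = 2l² κ(l−1,i) (−1)^j C(2i+1, j)` if `j + k = 2i + 1`, and `0` otherwise. -/
theorem eval_iterate_lapC_tripleC_Phi {l i : ℕ} (hi : i + 1 ≤ l) (j k : ℕ) :
    eval e0 (lapC^[i] (tripleC (Phi l j) (Phi l k)))
      = if j + k = 2 * i + 1 then 2 * (l : ℂ) ^ 2 * ladder (l - 1) i * (-1) ^ j * ((2 * i + 1).choose j : ℂ) else 0 := by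
  classical
  by_cases hj : j < 2 * l + 1
  · by_cases hk : k < 2 * l + 1
    · have h := congrArg (coeff (ext 0 j k)) (evG_iterate_lapG_tripleG_eq_sum l i)
      rw [evG_iterate_lapG_tripleG hi, coeff_ext_sum_sum _ _ _ hj hk, coeff_C, if_pos rfl, coeff_ext_C_mul_dST_pow] at h
      rw [← h]
    · rw [Phi_eq_zero_of_lt (show 2 * l < k by omega)]
      have h0 : tripleC (Phi l j) 0 = 0 := by simp [tripleC, lam]
      rw [h0, iterate_lapC_zero, map_zero, if_neg (by omega)]
  · rw [Phi_eq_zero_of_lt (show 2 * l < j by omega)]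
    have h0 : tripleC 0 (Phi l k) = 0 := by simp [tripleC, lam]
    rw [h0, iterate_lapC_zero, map_zero, if_neg (by omega)]

end Certificate

end Summit.NavierStokesRegularity.NavierStokesRegularity.Theorems.UnthreadedRigidity.VirialHorn.Coherent

end
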